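import Mathlib
import Summits.Ventures.HodgeRepro.Tier4.Common.RowWeights
import Summits.Ventures.HodgeRepro.Tier4.Common.LocalCoordinatesConj

/-!
# Tier4/Line4/ArchSeesawBridge — the binders of `d3CoeffData'_archWitness(')_of_fourier` from display (7a)'s OWN binders
at the seesaw instance: the place `w₀ = InfinitePlace.mk φ` below the embedding `φ = τ₀ ∘ algebraMap`, the `U(1,1)` signs
`ha1` / `ha3` at `w₀` from `_hpos`, the branch `he` from `_he` / `_he'` and `lam ≠ 0`, and the real-place reading of `adToC`

Blind re-derivation cell `pub-hodge-repro`, Tier 4 (README §9–§10), seat t4-L1-p5 (prover, gen 5; plan-4 g5 S15435 «the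
SEESAW INSTANCE of `hchi'`/`hall` — which of the `…_of_fourier` binders follow from the skeleton's `_ha`/`_hpos`/`hcm`/`_hiso` at
`seesawPlane`, which do not — a typed list» and the v0.41 carry-list (d) S15456).  Target tree path
`lean/Summits/Ventures/HodgeRepro/Tier4/Line4/ArchSeesawBridge.lean`.  On typer-2's `Common/RowWeights` (`adToC`,
`adToC_algebraMap`) and Mathlib's `InfinitePlace` API (`embedding_mk_eq_of_isReal`, `isReal_mk_iff`,
`Completion.extensionEmbedding_coe`); no printed input.

THE MATCHING (LINE L4 v0.40 L1301ff, the binders of `l4_d3CoeffData`, against `d3CoeffData'_archWitness(')_of_fourier`):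
* `W` — `seesawPlane q a g g' hgg' hg'g hgΩ = (mixedRow q (a 0) (a 2)).withTransportedTorus g g' hgg' hg'g hgΩ` by `rfl`;
* `[S.μ.IsHaarMeasure]` at `S := Setting.ofAdelicData W R μ DG fdG compG compT compT'` — `S.μ = μ` definitionally
  (`inferInstanceAs (μ.IsHaarMeasure)`, the wall's own `haveI` pattern);
* `[CompactSpace (torusInf' W)]` — the skeleton's `compactSpace_torusInf'_seesaw q a g g' hgg' hg'g hgΩ _ha lam _hlam _hiso hcm`;
* `[νinf'.IsHaarMeasure]` at `νinf' := haarInf' …` — `haarInf'_isHaar`;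
* `hall : ∀ w, w.IsReal ∧ IsCMAt q w` — `fun w => ⟨IsTotallyReal.isReal w, l4_isCMAt q _hq w⟩`;
* `ha1 : 0 < (adToC w₀ (algebraMap k (Ad k) (a 1))).re`, `ha3 : (adToC w₀ (algebraMap k (Ad k) (-1 * a 3))).re < 0` at
  `w₀ = InfinitePlace.mk φ`, `φ := d.τ₀.comp (algebraMap (kOf E) E)` — **`ha1_of_pos` / `ha3_of_pos`** below from
  `_hpos 1` / `_hpos 3` (`adToC (mk φ) (algebraMap x) = φ x` at a real place: `adToC_algebraMap_mk_of_isReal`);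
* `he : eP′ w₀ = eM′ w₀ + 3` (holomorphic branch) or `eM′ w₀ = eP′ w₀ + 3` (antiholomorphic) — **`he_of_he'`** below from
  `_he`, `_he'` and `(φ lam).re ≠ 0` (**`re_ne_zero_of_isReal`**: `lam ≠ 0`, `φ` real);
* `hchi' : ∀ w, ChiMatchesAt' W q w g g' (eP′ w) (eM′ w) R.chi'` — `_hchi'` VERBATIM;
* `γ₀` — the line's rational regular `γ₀` (the display's `∃ γ₀, IsLinRegular γ₀ ∧ …`);
* NOT from the binders (the support lemma's DISPLAYED hypotheses, plan-4's ruling S15435): `hdef` (definite at every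
  `w′ ≠ w₀` — from TargetV3 L175 `IsDefinite (H.map τ)` in the bridge wall, never assumed), `(μinf) [μinf.IsHaarMeasure]` +
  `hinf` (the `G_∞`-Haar measure and the `L¹` print), `hF` (the `T_∞`-Fourier coefficient at `γ₀`), `hpseudo` / `hpseudo'`.

WHAT IS PROVED (kernel, no print): `adToC_algebraMap_eq_embedding`, `adToC_algebraMap_mk_of_isReal`,
`im_eq_zero_of_isReal`, `re_ne_zero_of_isReal`, `ha1_of_pos`, `ha3_of_pos`, `he_of_he'`.  Nothing here says anything about
the status of the Hodge conjecture for CM abelian varieties, which is NOT proved (HC_CM is NOT proved by anyone in this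
repository).
-/

set_option autoImplicit false

noncomputable section

namespace Summit.Ventures.HodgeRepro.Tier4.Line4

open Summit.Ventures.HodgeRepro.Tier4.Common NumberField

section Bridge

variable {k : Type} [Field k] [NumberField k]

/-- `adToC w (algebraMap k (Ad k) x) = w.embedding x` (the principal adele read at `w` is the embedding). -/
theorem adToC_algebraMap_eq_embedding (w : InfinitePlace k) (x : k) :
    adToC w (algebraMap k (Ad k) x) = w.embedding x := by
  rw [adToC_algebraMap, InfinitePlace.Completion.algebraMap_apply, InfinitePlace.Completion.extensionEmbedding_coe,
    ← WithAbs.equiv_symm_apply, RingEquiv.apply_symm_apply]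

/-- at the place `mk φ` of a REAL embedding `φ`, the principal adele reads as `φ x`. -/
theorem adToC_algebraMap_mk_of_isReal (φ : k →+* ℂ) (hφ : ComplexEmbedding.IsReal φ) (x : k) :
    adToC (InfinitePlace.mk φ) (algebraMap k (Ad k) x) = φ x := by
  rw [adToC_algebraMap_eq_embedding, InfinitePlace.embedding_mk_eq_of_isReal hφ]

omit [NumberField k] in
/-- a real embedding takes real values: `(φ x).im = 0`. -/
theorem im_eq_zero_of_isReal (φ : k →+* ℂ) (hφ : ComplexEmbedding.IsReal φ) (x : k) : (φ x).im = 0 := by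
  rw [← ComplexEmbedding.IsReal.coe_embedding_apply hφ x, Complex.ofReal_im]

omit [NumberField k] in
/-- a real embedding is injective with real values: `x ≠ 0 → (φ x).re ≠ 0`. -/
theorem re_ne_zero_of_isReal (φ : k →+* ℂ) (hφ : ComplexEmbedding.IsReal φ) {x : k} (hx : x ≠ 0) :
    (φ x).re ≠ 0 := by
  intro h0
  have him := im_eq_zero_of_isReal φ hφ x
  have hz : φ x = 0 := Complex.ext h0 him
  exact hx ((map_eq_zero φ).1 hz)

/-- **`ha1` from `_hpos`**: `0 < (φ (a 1)).re` gives `0 < (adToC (mk φ) (algebraMap k (Ad k) (a 1))).re`. -/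
theorem ha1_of_pos (φ : k →+* ℂ) (hφ : ComplexEmbedding.IsReal φ) (a : Fin 4 → k)
    (hpos : ∀ i, 0 < (φ (a i)).re) :
    0 < (adToC (InfinitePlace.mk φ) (algebraMap k (Ad k) (a 1))).re := by
  rw [adToC_algebraMap_mk_of_isReal φ hφ]
  exact hpos 1

/-- **`ha3` from `_hpos`**: `0 < (φ (a 3)).re` gives `(adToC (mk φ) (algebraMap k (Ad k) (-1 * a 3))).re < 0`. -/
theorem ha3_of_pos (φ : k →+* ℂ) (hφ : ComplexEmbedding.IsReal φ) (a : Fin 4 → k)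
    (hpos : ∀ i, 0 < (φ (a i)).re) :
    (adToC (InfinitePlace.mk φ) (algebraMap k (Ad k) (-1 * a 3))).re < 0 := by
  rw [adToC_algebraMap_mk_of_isReal φ hφ, map_mul, map_neg, map_one, neg_one_mul, Complex.neg_re]
  exact neg_neg_of_pos (hpos 3)

omit [Field k] [NumberField k] in
/-- **the branch from `_he` / `_he'`**: with `r ≠ 0` (the real part of `τ₀ lam`, `lam ≠ 0`), `p − m = ±3` and
`_he' : (0 < r → p′ − m′ = p − m) ∧ (r < 0 → p′ − m′ = −(p − m))` give `p′ = m′ + 3 ∨ m′ = p′ + 3`. -/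
theorem he_of_he' {p m p' m' : ℤ} {r : ℝ} (hr : r ≠ 0) (he : p - m = 3 ∨ p - m = -3)
    (he' : (0 < r → p' - m' = p - m) ∧ (r < 0 → p' - m' = -(p - m))) :
    p' = m' + 3 ∨ m' = p' + 3 := by
  rcases lt_or_gt_of_ne hr with hneg | hpos
  · have h := he'.2 hneg
    rcases he with h3 | h3 <;> omega
  · have h := he'.1 hpos
    rcases he with h3 | h3 <;> omega

end Bridge

end Summit.Ventures.HodgeRepro.Tier4.Line4

end
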